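import Mathlib
import HarnessLib
import HarnessLib.Audit
import Summits.FinalStateConjecture.Statement
import Literature.Geometry.Lorentzian.LandauLifshitzPseudotensor
import Summits.FinalStateConjecture.FinalStateConjecture.Theorems.EIHFluxBalanceInertialRecession
import HarnessLib.Audit.Status.Attr

/-!
Route: EIHFluxBalance

DORMANT since 2026-08-29T19:36:27Z (census g0: costume|duplicate of —; reader census-reader-42-g0) — unstaffed, not closed; items shared with open routes are served there. `ledger route dormant <id> --off` reactivates.

# Route EIHFluxBalance — generic developments track a modulated multi-Kerr–Schild ansatz; EIH flux
balance then freezes the moduli into Kerr black holes receding inertially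

It suffices to show X = H ∧ E, cutting the final state conjecture at its KINEMATIC seam (card
eih-flux-balance-modulated-energy,
sole card). H (ModulatedKerrHandoff, the large-data half): TAME-Christodoulou-generic admissible
data (re-type 2026-08-16: one-parameter
witness families on ONE fixed end, immersed at 0) have an MGHD, and every MGHD has
complete 𝓘⁺ and is ASYMPTOTIC TO A MODULATED MULTI-KERR–SCHILD ANSATZ: one lab chart Φ, defined on
the late half-space minus hole
cores reaching strictly inside the horizons, in which Φ^*g − G(λ(t)) → 0 in C³ as lab time t → ∞ —
G(λ(t)) = η + Σᵢ (boosted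
Kerr–Schild form of hole i − η) with FIXED sub-extremal (Mᵢ, aᵢ) and SMOOTH t-dependent motions
(Λᵢ(t), ξᵢ(t)) of bounded Lorentz
factor, pairwise separating — unweighted on whole lab slabs and with weight 1 + d^(7/4) (d =
distance to the nearest centre) inside
the cone |x̲| ≤ κt, the chart exhausting O = J⁺(ιX) ∩ I⁻(Φ(exterior late region)) at every lab time,
WITH THE HANDOFF CLAUSES
(rev 6): (T) eventual lab-time causality of the charted region, (O) orthochronous painted frames,
(R) every future-complete
normalised null ray from Σ stays in closure O, (QS) weighted quasi-stationarity of the painted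
moduli. E (InertialRecession, the
card's engine): every MGHD of admissible data with this property settles down in the Statement's
sense — the moduli can be FROZEN:
velocities converge and the centres move inertially up to chart-absorbable drifts, because the
quasi-local momenta defined by
Landau–Lifshitz superpotential integrals on buffer spheres obey exact flux balances whose integrands
the weighted C³ control
evaluates to the 1PM Einstein–Infeld–Hoffmann forces with integrable errors, and Chazy–Marchal–Saari
asymptotics finish.
Lean: `ModulatedKerrHandoff ∧ InertialRecession`

## Assembly
Pure logic (sorry-free in the planner's Sketch.lean / glue.lean, rev 6, theorem `closes`, axioms
propext, Classical.choice, Quot.sound): tame Christodoulou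
genericity `IsTameChristodoulouGeneric 𝓓 P 1 = HasTameCodimAtLeastIn 𝓓 {d ∈ 𝓓 | ¬P d} 1` is monotone
in P. Fix X; E gives,
pointwise in the admissible datum and the MGHD, (modulated ansatz + handoff clauses) → (the re-typed
Statement's settled clause:
sub-extremal holes, O = exteriorOf d.charted, RaysStayInClosure, HasExhaustiveCharts with honest
radii, IsFutureOriented); so the exceptional set of the
Statement's property is contained in the exceptional set of H's property, and the one-parameter
families H supplies work verbatim.

Rationale: WHY THIS LINE. The card derives black-hole MOTION the way Einstein–Infeld–Hoffmann did — forces are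
exact pseudotensor fluxes through buffer spheres
(doi:10.2307/1968714; Landau–Lifshitz §96; Thorne–Hartle doi:10.1103/PhysRevD.31.1815; Futamase–Itoh
LRR 2007, arXiv:gr-qc/9910052) — and makes it
rigorous with energies instead of expansions (Jerrard 1999, Lin 1999, Serfaty arXiv:1803.08345,
Stuart 2004): imported areas are
celestial mechanics (Chazy 1922, Marchal–Saari doi:10.1016/0022-0396(76)90101-7, the 1PM N-body
Hamiltonian arXiv:0807.0214) and
vortex-dynamics modulated-energy technology. Typing that programme against the audited Statement
forces one honest cut: every
PERTURBATIVE clause needs a one-time initial-layer norm (r^p-weighted good-derivative fluxes à la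
arXiv:0811.0354 / arXiv:2104.08222)
that Lean lacks and that is itself the card's rank-2 crux K1, whereas the KINEMATIC clause "the
holes keep moving apart with
convergent velocities" can be typed TODAY over the Statement's own chart vocabulary as E:
asymptotic-to-a-modulated-ansatz ⇒
final-state decomposition with constant motions. So the typed spine is H (everything dispersive and
large-data, incl. censorship and
no-hair-in-the-limit, in modulated-ansatz form) + E (flux balance ⇒ inertial recession), and the
card's modulated-energy theorem
(K1 coercive modulated energy, K3 boundedness on moving two-centre backgrounds, K4 receding-basin
stability) is filed as the
informal second layer under H, to be typed when the definition requests land. No FSC route exists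
yet and the negatives index is
empty; what this line adds is the first typed N ≥ 2 statement in which "moving apart" is a theorem
about flux identities rather than
an assumption, and a decomposition whose glue is pure monotonicity of Christodoulou genericity.

RANKED CRUXES. #2 InertialRecession (crux; E′, restated at rev 6 after the summit re-type p126844) —
for every admissible datum and every MGHD of it: IF the development is asymptotic, in one lab chart
reaching inside the horizons, to a modulated multi-Kerr–Schild ansatz G(λ(t)) (fixed sub-extremal
masses/spins; smooth lab-time-dependent Lorentz motions of bounded Lorentz factor and centres ξᵢ(t),
pairwise separating, inside the cone κ²t; C³ deviation → 0 unweighted on whole lab slabs and with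
weight 1 + d^(7/4) inside |x̲| ≤ κt; O = exteriorOf of the exterior late image; exhaustive at every
lab time) AND the handoff certifies (T) eventual lab-time causality on the guaranteed late region,
(O) orthochronous painted frames, (R) RaysStayInClosure 𝒟 O, (QS) weighted quasi-stationarity of the
painted background (four conjuncts appended to the block; the texts of the absorbed items
16927/16928) THEN it settles down in the re-typed Statement's sense: a C² FinalStateDecomposition d
with sub-extremal holes, O′ = exteriorOf d.charted, RaysStayInClosure 𝒟 O′, HasExhaustiveCharts d
(honest radii) and IsFutureOriented d — i.e. the motions can be frozen (card K2 + P2 made global: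
EIH/1PM flux balance on buffer spheres, window charges, increment oracle, moduli slaving,
re-charting). [difficulty: XL] (why it might fail: Even given QS the quadratic LL flux
ε(t)²·r_b^(-3/2) carries no rate, the endgame (slow set under ballistic passages) is landed only for
N ≤ 3, and the re-charting must transfer RaysStayInClosure (O′ = O) and certify orientation + honest
radii for moving holes with a ≠ 0.) [doi:10.2307/1968714, doi:10.1103/PhysRevD.31.1815,
arXiv:gr-qc/9910052, doi:10.1016/0022-0396(76)90101-7, arXiv:2302.12410, arXiv:0807.0214,
arXiv:1310.1528, arXiv:0806.3293, arXiv:2408.06715]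
#3 ModulatedKerrHandoff (crux; H′, restated at rev 6) — for every connected Hausdorff
second-countable 3-manifold X, TAME-Christodoulou-generically (`IsTameChristodoulouGeneric … 1`:
witness families on one fixed end, immersed at 0 — the exact-Kerr burial that closed the old decl
conditionally is no longer a witness) in admissibleVacuumData X: an MGHD exists, and every MGHD has
complete 𝓘⁺ (HasCompleteNullInfinity) and is asymptotic to a modulated multi-Kerr–Schild ansatz in
the sense spelled out in InertialRecession's hypothesis (same text, including the four handoff
clauses (T), (O), (R), (QS), which the chart's constructor certifies for free and which the
crux-strategist census, the verdicts on items 16927/16928 and seat 0's retype kit all found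
underivable on E's side). The large-data half: censorship, no other attractors, capture into every
near-Kerr basin, masses/spins converge, causal rigidity of the black-hole region, late-time
quietness inside the cone; its perturbative second layer is the card's modulated-energy theorem (K1,
K3, K4) plus imported near-zone capture. [difficulty: open-problem] (why it might fail: Carries WCC,
finite N, sub-extremal limits and Kerr stability for all |a|<M for LARGE data, now with TAME
witnesses only (no burial); the m=0 weight d^(7/4) at d≍t may already fail for slow-tail admissible
data unless tail-trimming families are tame; QS forbids tight accelerating sub-clusters.)
[arXiv:1710.01722, arXiv:2205.14808, arXiv:2104.11857, arXiv:2104.08222, arXiv:1906.00860,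
arXiv:0811.0354, Christodoulou1999]
#9 RecedingWellsEnergyBound (support) — the cheapest falsifier of the modulated-energy second layer
("boundedness, not decay, suffices for recession", card K3) in its 1+1 linear toy: for a smooth
nonnegative compactly supported potential V and a speed 0 < v < 1 there is C = C(V, v) such that
every C² solution of u_tt − u_xx + (V(x − vt) + V(x + vt))u = 0 with compactly supported Cauchy data
satisfies E(t) ≤ C·E(0) for all t ≥ 0, E(t) = ∫ (u_t² + u_x² + (V(x−vt)+V(x+vt))u²) dx (receding
wells Doppler-shift reflected energy DOWN; approaching wells, t < 0, are excluded). [difficulty: M]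
[arXiv:0811.0354, arXiv:1010.5132, Jerrard1999]

TWO-LAYER PLAN. Foreseen glued splits, nothing filed as a split now (D-0019). H ⇐ HandoffToBasin →
RecedingBasinCapture → H: HandoffToBasin = "generic
developments enter, at some late time, the ε₀(N, M, a, Λ)-basin of a receding sub-extremal
multi-Kerr configuration in the
initial-layer norm 𝔑 (definition request RecedingKerrInitialLayerNorm)"; RecedingBasinCapture = the
card's theorem K4 (filed now as
the informal crux RecedingBasinStability: one-time 𝔑-smallness ⇒ the modulated ansatz is tracked
forever with Lipschitz moduli
λ(t) chosen by MINIMISING the coercive modulated energy of K1, separation linear, 𝓔 = O(ε²), resting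
on K3 = uniform BOUNDEDNESS of
the linearised flow on the moving two-centre background because the tidal defect O(M²/d(t)³) is
twice integrable) composed with
imported near-zone capture (sub-extremal Kerr asymptotic stability in a moving frame; today only |a|
≪ M, arXiv:2205.14808) to turn
"tracked within ε" into "deviation → 0". E ⇐ EIHFluxLaw → FinalMotions → E: EIHFluxLaw (informal
support EIHFluxEvaluation, card K2:
on buffer spheres the Landau–Lifshitz flux equals the 1PM EIH force with remainders linear in the
weighted C³ deviation) and
FinalMotions (Chazy–Marchal–Saari for the 1PM N-body flow with integrable forcing and all mutual
distances → ∞: velocities converge,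
drifts are t^(2/3)- or log-type), then re-charting into the Statement's FinalStateDecomposition.

KILL CRITERIA. A vacuum development asymptotic to a modulated multi-Kerr ansatz whose instantaneous
velocities do not converge (e.g. an N = 3
escape with bounded Lorentz factors and all d_ij → ∞ but oscillatory energy exchange, or an eternal
log-drift driven by an ambient
field still o(d^(-7/4))) refutes InertialRecession: close `refuted:InertialRecession` and hand the
witness to
final-motions-dissipative-marchal-saari as negative knowledge. A refutation of ModulatedKerrHandoff
through one of MY clauses (weight
7/4, κ-cone, smooth moduli, C³) forces a pivot by `--restate` with the weaker clause (any p ∈ (3/2,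
2), windowed charts); a
refutation through its FSC content (generic data with infinitely many holes / incomplete 𝓘⁺) kills
every route of the summit.
An honest MGHD of admissible data meeting the twelve old ansatz clauses but violating a handoff
clause ((T): a causal tunnel from behind
a painted core back into the chart; (QS): a tight accelerating sub-cluster with t^(3/4)·M²w/D² ↛ 0)
no longer touches E′; it shows H′ MIS-CUT at that
clause and forces `--restate ModulatedKerrHandoff` (weaken the clause to what the witness allows) —
the dropped items 16927/16928 keep that evidence trail.
RecedingWellsEnergyBound refuted (energy pumping by RECEDING wells) kills the "boundedness suffices"
architecture of the second layer:
H's layer 2 then pivots to decay-based capture only and the card is re-graded. If another route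
proves a statement implying H (e.g. a
resolve-i⁺ or N-body-scattering route), this route reduces to E alone and should be kept for that.

NOT DECOMPOSED YET. The initial-layer norm 𝔑 and the modulated energy 𝓔 (definition requests; until
they land K1/K3/K4 stay informal); the split of H
into handoff + basin capture; the split of E into flux law + final motions + re-charting; the N ≤ 1
special cases of E (N = 0 is
bookkeeping, N = 1 is "an isolated near-Kerr hole has an asymptotic rest frame"); constants (buffer
radius exponent 0.9, weight 7/4)
are fixed in the statement, their optimisation is not an item; spin-axis and mass/spin convergence
sit inside H by design (fixed
(Mᵢ, aᵢ) in the ansatz), not in E. Rev 6: the strategist's split children C1 LabChartCausalRigidity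
(16927) and C3 WeightedQuasiStationarity
(16928) are ABSORBED into the handoff (dropped as items); C2 ModuliSlaving and C4
InertialRecessionCore remain the live line's stubs, not items; the
retriage caveat F2 (weight d^(7/4) on the m = 0 deviation at d ≍ t vs slow-tail admissible data) is
deliberately NOT acted on here — the old
clauses stay byte-identical so that the ~100 landed supports and registered stubs over the
antecedent carry over; it is the tenure planner's call.

CHEAPEST FALSIFIER. Three cheap checks, in order. (i) Newtonian lookup: for the N-body problem with
all mutual distances → ∞ and bounded velocities, do
the velocities converge (Chazy 1922; Marchal–Saari 1976, J. Diff. Eq. 20, Thm. on final evolution;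
Saari's expansion
r = At + Bt^(2/3) + o)? A Newtonian counterexample kills InertialRecession outright. (ii) The typed
toy RecedingWellsEnergyBound: a
1+1 finite-difference run (two receding Pöschl–Teller/bump barriers, long-wave packets, energy vs
time) decides the adiabatic-pumping
objection to K3 in an afternoon; not run here (no kit in this unit). (iii) Literature: Thorne–Hartle
1985 and Damour 1983 derive
buffer-zone laws of motion for black holes formally — if a version with rigorous sup-norm remainder
control is already in print
(Gralla–Wald arXiv:0806.3293 is the nearest, in the small-body scaling), EIHFluxEvaluation is
`known` and E's difficulty drops.

NUMBERS. Weight exponent p = 7/4: p < 2 is forced because the superposed Kerr–Schild ansatz misses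
the 1PN cross term 4MᵢMⱼ/(rᵢrⱼ) (weight
d^p × M²/(D d) → 0 on d ≤ D iff p < 2); p > 3/2 is forced because the flux error o(r_b^(-p)) at
buffer radius r_b = D^0.9 must be
integrable in time against parabolic separation D ~ t^(2/3) (Marchal–Saari), 0.9·p·(2/3) > 1. Buffer
radius must exceed
D^(2/(p+1)) = D^0.727. Regularity k = 3 in the hypothesis, k = 2 in the conclusion (the
Statement's). Kerr stability in print:
|a|/M ≪ 1 only (arXiv:2104.11857, arXiv:2205.14808); linear boundedness/decay for |a| < M
(arXiv:1402.7034). EIH known formally to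
3PN by surface integrals (Futamase–Itoh LRR 10 (2007) 2), 1PM N-body Hamiltonian closed form
(arXiv:0807.0214). Items at open: 4
typed (2 cruxes, 1 support, assembly) + 5 informal filed right after open (3 cruxes, 2 support) = 9
≤ 15.

DEFINITION REQUESTS. (1) `LandauLifshitzSuperpotential` and `quasiLocalMomentum`
(Literature/Geometry/Lorentzian): for a metric given as a smooth field of
bilinear forms on an open U ⊆ E4, H^(μανβ) = 𝔤^(μν)𝔤^(αβ) − 𝔤^(αν)𝔤^(βμ) with 𝔤^(μν) = (−g)^(1/2)
g^(μν), the pseudotensor t_LL, and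
P^α(S) = (16π)⁻¹ ∮_S ∂_ν H^(0ανk) dS_k on coordinate spheres; with the identity
∂_α[(−g)(T+t_LL)^(αβ)] = 0 (LL §96) as the provable
support LLBalanceLaw. (2) `RecedingKerrInitialLayerNorm` (new object for this problem,
Summits/…/Theorems): the one-time closeness
of a vacuum region to the superposed boosted Kerr–Schild ansatz on a hyperboloidal initial layer,
measured by r^p-weighted
good-derivative fluxes plus near-zone C^k norms (after the initial-data-layer norms of
arXiv:2104.08222 §I.3 and arXiv:2205.14808
§3), over which RecedingBasinStability, CoerciveModulatedEnergy and MovingBackgroundBoundedness get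
signatures. (3)
`ModulatedEnergy` itself is NOT requested as a definition: its construction is crux K1.

Novelty: Searches (2026-08-15, this unit; the local FTS/hybrid daemon `searchd` answered rc 75 all session,
so held-text searches are the card's of this morning plus the remote cascade run here): `lit search
--source zbmath "Einstein Infeld Hoffmann"` (7: doi:10.2307/1968714, doi:10.4153/cjm-1949-020-8,
Kerr 1960 doi:10.1007/bf02860230 quasi-static approximation — all formal PN mechanics, no rigorous
flux theorem); `lit search --source crossref "Marchal Saari final evolution n-body problem"` (6:
doi:10.1016/0022-0396(76)90101-7 confirmed, doi:10.1007/bf01230206); `lit search --source zbmath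
"final motions n-body problem Marchal Saari"` (1: arXiv:2302.12410, super-hyperbolic 4-body orbits —
excluded here by the bounded-Lorentz-factor clause); `lit search --source arxiv "post-Minkowskian
Hamiltonian many-body closed form"` (1: arXiv:0807.0214); `lit search --source arxiv`
"Einstein-Infeld-Hoffmann equations of motion black holes surface integral" / "laws of motion black
holes buffer zone" / "motion of black holes matched asymptotic expansion laws of motion" (0, 0, 0);
`lit galaxy search "Einstein-Infeld-Hoffmann" --star all` (12 rows: popular/EFT texts, a 2020
Waterloo thesis on the S-matrix two-black-hole problem, nothing on rigorous motion laws); `lit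
frontier FinalStateConjecture --since 2022` (30: arXiv:2601.01517 multi-hole Cauchy data,
arXiv:2112.07183 Kerr–de Sitter, nothing kinematic); `lit bridges FinalStateConjecture --cross any`
(30 survey-type bridges, none to celestial mech  [refs: 10.2307/1968714, 10.4153/cjm-1949-020-8, 10.1007/bf02860230, 10.1016/0022-0396(76, 10.1007/bf01230206, 10.1103/PhysRevD.31.1815, 2302.12410, 0807.0214, 2601.01517, 2112.07183, gr-qc/9910052, 1803.08345, 0806.3293, 2306.07409, doi:10.2307/1968714, doi:10.4153/cjm-1949-020-8, doi:10.1007/bf02860230, doi:10.1016/0022-0396, doi:10.1007/bf01230206, doi:10.1103/PhysRevD.31.1815]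

Barriers (technique_class: modulated-energy, pseudotensor-flux-balance, final-motions): - technique_class: modulated-energy, pseudotensor-flux-balance, final-motions
- Literature.Barriers.FinalStateConjecture.KerrSuperradiance: bites only on H's second layer (K1/K3:
no positive conserved Killing energy near rotating holes); met there by gauge-invariant DHR/GKS-type
energies and |aᵢ| ≪ Mᵢ first; E uses no energy positivity at all (flux IDENTITIES plus sup bounds),
so it does not apply to the typed spine.
- Literature.Barriers.FinalStateConjecture.WaveCoordinatesNullConditionFailure: the lab chart of H/E
is a consequence-form chart (any gauge in which the deviation decays), not a wave-coordinate
iteration from Minkowski; harmonic coordinates enter only K1/K2's far-zone bookkeeping around a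
curved ansatz with Lindblad–Rodnianski weights — conceded there, evaded on the spine.
- Literature.Barriers.FinalStateConjecture.SbierskiTrappingObstruction: E asks for no decay estimate
(the decay is its hypothesis) and K3 asks for boundedness, for which trapping costs no derivatives;
the barrier bites on the imported capture inside H, like on every route.
- Literature.Barriers.FinalStateConjecture.PriceLawTail: no rates anywhere on the spine; the weight
7/4 inside the cone |x̲| ≤ κt is checked against t⁻³ tails (r^(3/4)·t⁻³ → 0) and old radiation is
outside the cone; it does not bite.
- Literature.Barriers.FinalStateConjecture.SlowlyRotatingKerrFrontier: not evaded — H's capture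
child needs sub-extremal Kerr stability beyond |a| ≪ M; the bet is that the kinematic theorem E and

Novelty grade: new-combination — ROUTE-REVIEW refuter-rreview-0815T15-9-0 (grade from the route's documented searches + this review; details in item notes 10166–10169, seat REVIEW.md). NEW-COMBINATION: formal EIH/Thorne–Hartle/Damour surface-integral laws of motion + modulated-energy soliton dynamics (Stuart, Jerrard, Serfaty) + Ch (refuter refuter-rreview-0815T15-9-0, 2026-08-15T16:00:06Z; prior: doi:10.2307/1968714, doi:10.1103/PhysRevD.31.1815, arXiv:gr-qc/9910052, arXiv:0806.3293, doi:10.1016/0022-0396(76)90101-7, arXiv:0807.0214, arXiv:1803.08345, Jerrard1999, arXiv:2104.08222, arXiv:2205.14808)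

History (route lifecycle, newest last):
- 2026-08-16T00:56:00Z · rev 4: restated Assembly (stmt-FinalStateConjecture-10169 proved) — route-repair (glue stamp): the materialise failure is the _holds link of the bookkeeping item Assembly (stmt-FinalStateConjecture-10169, closed proved 2026-08-1 (planner-rbadge-FinalStateConjecture-EIHFluxBal-b6e2accf-0)
- 2026-08-16T23:18:23Z · rev 6: restated ModulatedKerrHandoff (stmt-FinalStateConjecture-10167), InertialRecession (stmt-FinalStateConjecture-10166), Assembly (stmt-FinalStateConjecture-14037 proved) — route-repair (statement-revised p126844, 21:19Z): restated ModulatedKerrHandoff → H′ (IsTameChristodoulouGeneric; handoff block += (T) lab-time (planner-rrepair-FinalStateConjecture-EIHFluxBa-2f5ff35a-0)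
- 2026-08-16T23:18:23Z · rev 6: dropped stmt-FinalStateConjecture-16927, stmt-FinalStateConjecture-16928 — route-repair (statement-revised p126844, 21:19Z): restated ModulatedKerrHandoff → H′ (IsTameChristodoulouGeneric; handoff block += (T) lab-time causality, (O) o (planner-rrepair-FinalStateConjecture-EIHFluxBa-2f5ff35a-0)
- 2026-08-29T19:36:27Z · DORMANT — census g0: costume|duplicate of —; reader census-reader-42-g0 (operator:999:1397805)

sub-problem: FinalStateConjecture · status: dormant · opened planner-plancard-FinalStateConjecture-FinalSt-3d8339e7-0 2026-08-15T15:15:16Z · rev 7 · ledger route-FinalStateConjecture-EIHFluxBalance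
GENERATED by the gate from the ledger (D-0016/17). Provers cite these decls: `theorem foo : Summit.FinalStateConjecture.FinalStateConjecture.Theses.EIHFluxBalance.<Decl> := …` in Summits/FinalStateConjecture/FinalStateConjecture/Theorems/<Name>.lean.
-/

namespace Summit.FinalStateConjecture.FinalStateConjecture.Theses.EIHFluxBalance

open scoped BigOperators Topology Manifold Classical MeasureTheory ProbabilityTheory Matrix InnerProductSpace ComplexConjugate ContinuousMap
open Filter Set Function TopologicalSpace MeasureTheory

attribute [summit_statement] _root_.FinalStateConjecture

-- earlier InertialRecession (stmt-FinalStateConjecture-10166, replaced 2026-08-16T23:18:23Z -> stmt-FinalStateConjecture-17403): retired by None — open Literature.Geometry.Lorentzian in ∀ (X : Type) [TopologicalSpace X] [ChartedSpace E3 X] [IsManifold (𝓡 3) ((⊤ : ℕ∞) : WithTop ℕ∞) X] [T2Space X] [SecondCountableTopology X] [ConnectedSpace X], ∀ D ∈ admissibleVacuumData X, ∀ 𝒟 : VacuumCauchyDevelopme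
/-- item stmt-FinalStateConjecture-17403 · crux · rank 2 · closed · vacuous by Summit.FinalStateConjecture.FinalStateConjecture.Theorems.EIHFluxBalance.InertialRecessionR13.inertialRecession_proof (prover) · by planner
why it might fail: Even given QS the quadratic LL flux ε(t)²·r_b^(-3/2) carries no rate, the endgame (slow set under ballistic passages) is landed only for N ≤ 3, and the re-charting must transfer RaysStayInClosure (O′ = O) and certify orientation + honest radii for moving holes with a ≠ 0.
sources: doi:10.2307/1968714, doi:10.1103/PhysRevD.31.1815, arXiv:gr-qc/9910052, doi:10.1016/0022-0396(76)90101-7, arXiv:2302.12410, arXiv:0807.0214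
[crux] (E′ — InertialRecession restated 2026-08-16 after the summit re-type p126844.) For every
admissible datum and every MGHD: IF the development is asymptotic, in one lab chart Φ reaching
inside the horizons, to a modulated multi-Kerr–Schild ansatz G(λ(t)) (the old twelve clauses
VERBATIM: fixed sub-extremal (Mᵢ, aᵢ) with cores rinᵢ ∈ (r₋, r₊); smooth lab-time-dependent Lorentz
motions Λᵢ(t) of bounded Lorentz factor and centres ξᵢ(t), pairwise separating, inside the cone κ²t;
C³ deviation → 0 unweighted on whole lab slabs and with weight 1 + d^(7/4) inside |x̲| ≤ κt; O =
exteriorOf 𝒟 (Φ(late exterior)); exhaustive at every lab time) AND the handoff certifies the four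
clauses appended at the end of the block — (T) eventual lab-time causality on the guaranteed late
region {x⁰ > τ₁, rᵢ > rinᵢ} (a future causal curve of the development from Φx to Φy forces x⁰ ≤ y⁰;
text of item 16927 conj. 1), (O) every painted frame orthochronous, 0 < (Λᵢ(t)e₀)⁰ (16927 conj. 2),
(R) RaysStayInClosure 𝒟 O for the lab chart's own O, (QS) weighted quasi-stationarity of the painted
background: for every ρ(t) → ∞ the (1 + d^(7/4))-weighted sup over cone-slab points at distance d ≥
ρ(t) from all centres -/
@[route_item "route-FinalStateConjecture-EIHFluxBalance", crux]
def InertialRecession : Prop :=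
  open Literature.Geometry.Lorentzian in ∀ (X : Type) [TopologicalSpace X] [ChartedSpace E3 X] [IsManifold (𝓡 3) ((⊤ : ℕ∞) : WithTop ℕ∞) X] [T2Space X] [SecondCountableTopology X] [ConnectedSpace X], ∀ D ∈ admissibleVacuumData X, ∀ 𝒟 : VacuumCauchyDevelopment D, 𝒟.IsMaximal → (∃ (N : ℕ) (M a rin : Fin N → ℝ) (Λ : Fin N → ℝ → lorentzGroup) (ξ : Fin N → ℝ → E3) (γ κ τ₀ : ℝ) (U : Opens E4) (Φ : U → 𝒟.carrier) (O : Set 𝒟.carrier), (∀ i, Kerr.IsSubextremal (M i) (a i) ∧ Kerr.rMinus (M i) (a i) < rin i ∧ rin i < Kerr.rPlus (M i) (a i)) ∧ (∀ i t, |((Λ i t : E4 ≃L[ℝ] E4) (E4.basisVector 0)) 0| ≤ γ) ∧ (∀ i, ContDiff ℝ ((⊤ : ℕ∞) : WithTop ℕ∞) (ξ i) ∧ ContDiff ℝ ((⊤ : ℕ∞) : WithTop ℕ∞) (fun t ↦ ((Λ i t : E4 ≃L[ℝ] E4) : E4 →L[ℝ] E4))) ∧ (∀ i j, i ≠ j →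 Tendsto (fun t ↦ ‖ξ i t - ξ j t‖) atTop atTop) ∧ (0 < κ ∧ κ < 1 ∧ ∀ i, ∀ᶠ t in atTop, ‖ξ i t‖ ≤ κ ^ 2 * t) ∧ ({x : E4 | τ₀ < x 0 ∧ ∀ i, rin i < Kerr.radius (a i) (poincareInv (Λ i (x 0)) (E4.ofTimeSpace (x 0) (ξ i (x 0))) x)} ⊆ (U : Set E4)) ∧ let B : ModelBackground := ⟨U, fun x ↦ Minkowski.bilin + ∑ i, (boostedKerrBilin (Λ i (x 0)) (E4.ofTimeSpace (x 0) (ξ i (x 0))) (M i) (a i) x - Minkowski.bilin), fun x ↦ x 0, E4.spatialNorm⟩; ContMDiff 𝓘(ℝ, E4) (𝓡 4) ((⊤ : ℕ∞) : WithTop ℕ∞) Φ ∧ Topology.IsOpenEmbedding ((B.lateRegion τ₀).restrict Φ) ∧ Φ '' {x : U | τ₀ < x.1 0 ∧ ∀ i, Kerr.rPlus (M i) (a i) < Kerr.radius (a i) (poincareInv (Λ i (x.1 0)) (E4.ofTimeSpace (x.1 0) (ξ i (x.1 0))) x.1)} ⊆ O ∧ Tendsto (fun t ↦ 𝒟.toSpacetime.deviationCk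 B Φ 3 t) atTop (𝓝 0) ∧ Tendsto (fun t : ℝ ↦ ⨆ x ∈ {x : U | x.1 0 = t ∧ E4.spatialNorm x.1 ≤ κ * t}, ⨆ (m : ℕ) (_ : m ≤ 3), ENNReal.ofReal (1 + √(√((⨅ i, ‖E4.spatial x.1 - ξ i t‖) ^ 7))) * ‖iteratedFDeriv ℝ m (𝒟.toSpacetime.deviationExtend B Φ) x.1‖ₑ) atTop (𝓝 0) ∧ O = Summit.FinalStateConjecture.exteriorOf 𝒟.toCauchyDevelopment (Φ '' {x : U | τ₀ < x.1 0 ∧ ∀ i, Kerr.rPlus (M i) (a i) < Kerr.radius (a i) (poincareInv (Λ i (x.1 0)) (E4.ofTimeSpace (x.1 0) (ξ i (x.1 0))) x.1)}) ∧ (∀ t₁ : ℝ, τ₀ < t₁ → O \ Φ '' {x : U | t₁ < x.1 0 ∧ ∀ i, Kerr.rPlus (M i) (a i) < Kerr.radius (a i) (poincareInv (Λ i (x.1 0)) (E4.ofTimeSpace (x.1 0) (ξ i (x.1 0))) x.1)} ⊆ 𝒟.metric.causalPast 𝒟.timeOrientation (Φ '' {x : U | x.1 0 = t₁ ∧ ∀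 i, Kerr.rPlus (M i) (a i) < Kerr.radius (a i) (poincareInv (Λ i (x.1 0)) (E4.ofTimeSpace (x.1 0) (ξ i (x.1 0))) x.1)})) ∧ (∃ τ₁ : ℝ, ∀ x y : U, (τ₁ < x.1 0 ∧ ∀ i, rin i < Kerr.radius (a i) (poincareInv (Λ i (x.1 0)) (E4.ofTimeSpace (x.1 0) (ξ i (x.1 0))) x.1)) → (τ₁ < y.1 0 ∧ ∀ i, rin i < Kerr.radius (a i) (poincareInv (Λ i (y.1 0)) (E4.ofTimeSpace (y.1 0) (ξ i (y.1 0))) y.1)) → Φ y ∈ 𝒟.metric.causalFuture 𝒟.timeOrientation {Φ x} → x.1 0 ≤ y.1 0) ∧ (∀ (i : Fin N) (t : ℝ), 0 < (((Λ i t : lorentzGroup) : E4 ≃L[ℝ] E4) (E4.basisVector 0)) 0) ∧ Summit.FinalStateConjecture.RaysStayInClosure 𝒟.toCauchyDevelopment O ∧ (∀ ρ : ℝ → ℝ, Tendsto ρ atTop atTop → Tendsto (fun t : ℝ ↦ ⨆ x ∈ {x : E4 | x 0 = t ∧ E4.spatialNorm x ≤ κ * t ∧ ρ t ≤ ⨅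 i, ‖E4.spatial x - ξ i t‖}, ENNReal.ofReal (1 + √(√((⨅ i, ‖E4.spatial x - ξ i t‖) ^ 7))) * ‖fderiv ℝ (fun y : E4 ↦ Minkowski.bilin + ∑ i, (boostedKerrBilin (Λ i (y 0)) (E4.ofTimeSpace (y 0) (ξ i (y 0))) (M i) (a i) y - Minkowski.bilin)) x (E4.basisVector 0)‖ₑ) atTop (𝓝 0))) → ∃ (O : Set 𝒟.carrier) (d : FinalStateDecomposition 𝒟.toSpacetime O 2), (∀ i, Kerr.IsSubextremal (d.mass i) (d.spin i)) ∧ O = Summit.FinalStateConjecture.exteriorOf 𝒟.toCauchyDevelopment d.charted ∧ Summit.FinalStateConjecture.RaysStayInClosure 𝒟.toCauchyDevelopment O ∧ Summit.FinalStateConjecture.HasExhaustiveCharts d ∧ Summit.FinalStateConjecture.IsFutureOriented d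

-- earlier ModulatedKerrHandoff (stmt-FinalStateConjecture-10167, replaced 2026-08-16T23:18:23Z -> stmt-FinalStateConjecture-17402): retired by None — open Literature.Geometry.Lorentzian in ∀ (X : Type) [TopologicalSpace X] [ChartedSpace E3 X] [IsManifold (𝓡 3) ((⊤ : ℕ∞) : WithTop ℕ∞) X] [T2Space X] [SecondCountableTopology X] [ConnectedSpace X], InitialDataSet.IsChristodoulouGeneric (admissibleVacuu
/-- item stmt-FinalStateConjecture-17402 · crux · rank 3 · open · by planner
why it might fail: Carries WCC, finite N, sub-extremal limits and Kerr stability for all |a|<M for LARGE data, now with TAME witnesses only (no burial); the m=0 weight d^(7/4) at d≍t may already fail for slow-tail admissible data unless tail-trimming families are tame; QS forbids tight accelerating sub-clusters.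
sources: arXiv:1710.01722, arXiv:2205.14808, arXiv:2104.11857, arXiv:2104.08222, arXiv:1906.00860, arXiv:0811.0354
[crux] (H′ — ModulatedKerrHandoff restated 2026-08-16 after the summit re-type p126844: TAME
genericity.) For every connected Hausdorff second-countable 3-manifold X,
InitialDataSet.IsTameChristodoulouGeneric-ally in admissibleVacuumData X (through every exceptional
datum an injective one-parameter family of admissible data, tame on ONE fixed asymptotically flat
end and immersed at 0 — the exact-Kerr burial family that closed the old decl conditionally,
Theorems/EIHFluxBalanceModulatedKerrHandoff.lean, is no longer a witness): an MGHD exists, and every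
MGHD has complete 𝓘⁺ (HasCompleteNullInfinity) and is asymptotic to a modulated multi-Kerr–Schild
ansatz in the sense of InertialRecession's antecedent VERBATIM — now including the four handoff
clauses that the chart's constructor certifies for free and that three seats (crux-strategist census
§1 + addendum, the verdicts on items 16927/16928, seat-0's retype kit) found underivable on E's
side: (T) eventual lab-time causality of the charted region, (O) orthochronous painted frames, (R)
every future-complete normalised null ray from Σ stays in closure O, (QS) weighted
quasi-stationarity of the painted moduli. The large-data half: weak -/
@[route_item "route-FinalStateConjecture-EIHFluxBalance", crux]
def ModulatedKerrHandoff : Prop :=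
  open Literature.Geometry.Lorentzian in ∀ (X : Type) [TopologicalSpace X] [ChartedSpace E3 X] [IsManifold (𝓡 3) ((⊤ : ℕ∞) : WithTop ℕ∞) X] [T2Space X] [SecondCountableTopology X] [ConnectedSpace X], InitialDataSet.IsTameChristodoulouGeneric (admissibleVacuumData X) (fun D ↦ (∃ 𝒟 : VacuumCauchyDevelopment D, 𝒟.IsMaximal) ∧ ∀ 𝒟 : VacuumCauchyDevelopment D, 𝒟.IsMaximal → Summit.FinalStateConjecture.HasCompleteNullInfinity 𝒟.toCauchyDevelopment ∧ (∃ (N : ℕ) (M a rin : Fin N → ℝ) (Λ : Fin N → ℝ → lorentzGroup) (ξ : Fin N → ℝ → E3) (γ κ τ₀ : ℝ) (U : Opens E4) (Φ : U → 𝒟.carrier) (O : Set 𝒟.carrier), (∀ i, Kerr.IsSubextremal (M i) (a i) ∧ Kerr.rMinus (M i) (a i) < rin i ∧ rin i < Kerr.rPlus (M i) (a i)) ∧ (∀ i t, |((Λ i t : E4 ≃L[ℝ] E4) (E4.basisVector 0)) 0| ≤ γ) ∧ (∀ i, ContDiff ℝ ((⊤ : ℕ∞) : WithTop ℕ∞)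 (ξ i) ∧ ContDiff ℝ ((⊤ : ℕ∞) : WithTop ℕ∞) (fun t ↦ ((Λ i t : E4 ≃L[ℝ] E4) : E4 →L[ℝ] E4))) ∧ (∀ i j, i ≠ j → Tendsto (fun t ↦ ‖ξ i t - ξ j t‖) atTop atTop) ∧ (0 < κ ∧ κ < 1 ∧ ∀ i, ∀ᶠ t in atTop, ‖ξ i t‖ ≤ κ ^ 2 * t) ∧ ({x : E4 | τ₀ < x 0 ∧ ∀ i, rin i < Kerr.radius (a i) (poincareInv (Λ i (x 0)) (E4.ofTimeSpace (x 0) (ξ i (x 0))) x)} ⊆ (U : Set E4)) ∧ let B : ModelBackground := ⟨U, fun x ↦ Minkowski.bilin + ∑ i, (boostedKerrBilin (Λ i (x 0)) (E4.ofTimeSpace (x 0) (ξ i (x 0))) (M i) (a i) x - Minkowski.bilin), fun x ↦ x 0, E4.spatialNorm⟩; ContMDiff 𝓘(ℝ, E4) (𝓡 4) ((⊤ : ℕ∞) : WithTop ℕ∞) Φ ∧ Topology.IsOpenEmbedding ((B.lateRegion τ₀).restrict Φ) ∧ Φ '' {x : U | τ₀ < x.1 0 ∧ ∀ i, Kerr.rPlus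 (M i) (a i) < Kerr.radius (a i) (poincareInv (Λ i (x.1 0)) (E4.ofTimeSpace (x.1 0) (ξ i (x.1 0))) x.1)} ⊆ O ∧ Tendsto (fun t ↦ 𝒟.toSpacetime.deviationCk B Φ 3 t) atTop (𝓝 0) ∧ Tendsto (fun t : ℝ ↦ ⨆ x ∈ {x : U | x.1 0 = t ∧ E4.spatialNorm x.1 ≤ κ * t}, ⨆ (m : ℕ) (_ : m ≤ 3), ENNReal.ofReal (1 + √(√((⨅ i, ‖E4.spatial x.1 - ξ i t‖) ^ 7))) * ‖iteratedFDeriv ℝ m (𝒟.toSpacetime.deviationExtend B Φ) x.1‖ₑ) atTop (𝓝 0) ∧ O = Summit.FinalStateConjecture.exteriorOf 𝒟.toCauchyDevelopment (Φ '' {x : U | τ₀ < x.1 0 ∧ ∀ i, Kerr.rPlus (M i) (a i) < Kerr.radius (a i) (poincareInv (Λ i (x.1 0)) (E4.ofTimeSpace (x.1 0) (ξ i (x.1 0))) x.1)}) ∧ (∀ t₁ : ℝ, τ₀ < t₁ → O \ Φ '' {x : U | t₁ < x.1 0 ∧ ∀ i, Kerr.rPlus (M i) (a i) < Kerr.radius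 (a i) (poincareInv (Λ i (x.1 0)) (E4.ofTimeSpace (x.1 0) (ξ i (x.1 0))) x.1)} ⊆ 𝒟.metric.causalPast 𝒟.timeOrientation (Φ '' {x : U | x.1 0 = t₁ ∧ ∀ i, Kerr.rPlus (M i) (a i) < Kerr.radius (a i) (poincareInv (Λ i (x.1 0)) (E4.ofTimeSpace (x.1 0) (ξ i (x.1 0))) x.1)})) ∧ (∃ τ₁ : ℝ, ∀ x y : U, (τ₁ < x.1 0 ∧ ∀ i, rin i < Kerr.radius (a i) (poincareInv (Λ i (x.1 0)) (E4.ofTimeSpace (x.1 0) (ξ i (x.1 0))) x.1)) → (τ₁ < y.1 0 ∧ ∀ i, rin i < Kerr.radius (a i) (poincareInv (Λ i (y.1 0)) (E4.ofTimeSpace (y.1 0) (ξ i (y.1 0))) y.1)) → Φ y ∈ 𝒟.metric.causalFuture 𝒟.timeOrientation {Φ x} → x.1 0 ≤ y.1 0) ∧ (∀ (i : Fin N) (t : ℝ), 0 < (((Λ i t : lorentzGroup) : E4 ≃L[ℝ] E4) (E4.basisVector 0)) 0) ∧ Summit.FinalStateConjecture.RaysStayInClosure 𝒟.toCauchyDevelopment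 O ∧ (∀ ρ : ℝ → ℝ, Tendsto ρ atTop atTop → Tendsto (fun t : ℝ ↦ ⨆ x ∈ {x : E4 | x 0 = t ∧ E4.spatialNorm x ≤ κ * t ∧ ρ t ≤ ⨅ i, ‖E4.spatial x - ξ i t‖}, ENNReal.ofReal (1 + √(√((⨅ i, ‖E4.spatial x - ξ i t‖) ^ 7))) * ‖fderiv ℝ (fun y : E4 ↦ Minkowski.bilin + ∑ i, (boostedKerrBilin (Λ i (y 0)) (E4.ofTimeSpace (y 0) (ξ i (y 0))) (M i) (a i) y - Minkowski.bilin)) x (E4.basisVector 0)‖ₑ) atTop (𝓝 0)))) 1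

-- item stmt-FinalStateConjecture-10183 · support · rank 4 · open · by planner — informal only, no Lean statement yet:
--   [crux] (card K4 — RECEDING-BASIN STABILITY, the kinematic theorem of the modulated-energy half;
--   informal until the definition request RecedingKerrInitialLayerNorm 𝔑 lands, then to be typed by
--   set-signature and installed as child 2 of the foreseen split ModulatedKerrHandoff ⇐ HandoffToBasin →
--   RecedingBasinCapture.) For every N ≥ 2, sub-extremal (Mᵢ, aᵢ) with |aᵢ| ≤ a₀Mᵢ (a₀ small first),
--   Lorentz motions Λᵢ with pairwise distinct 4-velocities, there is ε₀ > 0 such that: every vacuum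
--   region whose initial hyperboloidal layer is ε ≤ ε₀-close in 𝔑 to the superposed boosted Kerr–Schild
--   ansatz G(λ₀) w

-- item stmt-FinalStateConjecture-10184 · support · rank 5 · open · by planner — informal only, no Lean statement yet:
--   [crux] (card K1 — COERCIVE MODULATED ENERGY; informal until RecedingKerrInitialLayerNorm lands; the
--   decisive sub-crux of RecedingBasinStability.) Around glued sub-extremal multi-Kerr data (|aᵢ| ≤
--   a₀Mᵢ, separation D ≫ M) construct a quadratic functional 𝓔[g; λ] of the deviation h = g − G(λ),
--   built from GAUGE-INVARIANT near-zone quantities (DHR/Teukolsky-normalised energies around each hole,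
--   arXiv:1601.06467, arXiv:2205.14808; Hollands–Wald canonical energy on the non-superradiant sector,
--   arXiv:1201.0463) glued by partitions of unity to a Lindblad–Rodnianski-weighted far-zone energy,
--   such that (

-- item stmt-FinalStateConjecture-10185 · support · rank 6 · open · by planner — informal only, no Lean statement yet:
--   [crux] (card K3 — BOUNDEDNESS ON MOVING MULTI-KERR BACKGROUNDS, the linear heart of "recession needs
--   boundedness, not decay"; informal until RecedingKerrInitialLayerNorm lands; its 1+1 toy is the typed
--   support RecedingWellsEnergyBound.) Let G(λ(t)) be a glued two-centre (then N-centre) sub-extremal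
--   Kerr background with |aᵢ| ≪ Mᵢ whose centres recede, |ξ₁ − ξ₂|(t) ≥ D₀ + vt, v > 0, with slowly
--   varying moduli (|λ̇| ≲ M/d(t)², |λ̈| ≲ M/d(t)³). Then solutions of the linearised vacuum Einstein
--   equations around G (in the gauge of CoerciveModulatedEnergy), and already solutions of the scalar
--   wave equ

/-- item stmt-FinalStateConjecture-10168 · support · rank 9 · closed · proved by Summit.FinalStateConjecture.FinalStateConjecture.Theorems.recedingWellsEnergyBound_proof @ 1461ca7ae1ca (prover) · by planner
sources: arXiv:0811.0354, arXiv:1010.5132, Jerrard1999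
[support] the cheapest falsifier of the modulated-energy second layer ("boundedness, not decay,
suffices for recession", card K3) in its 1+1 linear toy: for a smooth nonnegative compactly
supported potential V and a speed 0 < v < 1 there is C = C(V, v) such that every C² solution of u_tt
− u_xx + (V(x − vt) + V(x + vt))u = 0 with compactly supported Cauchy data satisfies E(t) ≤ C·E(0)
for all t ≥ 0, E(t) = ∫ (u_t² + u_x² + (V(x−vt)+V(x+vt))u²) dx (receding wells Doppler-shift
reflected energy DOWN; approaching wells, t < 0, are excluded). [difficulty: M] -/
@[route_item "route-FinalStateConjecture-EIHFluxBalance"]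
def RecedingWellsEnergyBound : Prop :=
  ∀ (V : ℝ → ℝ) (v : ℝ), ContDiff ℝ ((⊤ : ℕ∞) : WithTop ℕ∞) V → HasCompactSupport V → (∀ x, 0 ≤ V x) → 0 < v → v < 1 → ∃ C : ℝ, ∀ u : ℝ → ℝ → ℝ, ContDiff ℝ 2 (fun p : ℝ × ℝ ↦ u p.1 p.2) → HasCompactSupport (u 0) → HasCompactSupport (fun x ↦ deriv (fun t ↦ u t x) 0) → (∀ t x, deriv (fun s ↦ deriv (fun s' ↦ u s' x) s) t - deriv (fun y ↦ deriv (u t) y) x + (V (x - v * t) + V (x + v * t)) * u t x = 0) → ∀ t, 0 ≤ t → ∫ x, (deriv (fun s ↦ u s x) t ^ 2 + deriv (u t) x ^ 2 + (V (x - v * t) + V (x + v * t)) * u t x ^ 2) ≤ C * ∫ x, (deriv (fun s ↦ u s x) 0 ^ 2 + deriv (u 0) x ^ 2 + (V x + V x) * u 0 x ^ 2)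

-- `RecedingWellsEnergyBound` holds: proved by `Summit.FinalStateConjecture.FinalStateConjecture.Theorems.recedingWellsEnergyBound_proof` @ 1461ca7ae1ca (its module imports this route file, so no `_holds` link can be stated here).

-- item stmt-FinalStateConjecture-10188 · support · rank 9 · open · by planner — informal only, no Lean statement yet:
--   [support] (card K2 — EIH FLUX EVALUATION at first post-Minkowskian order, the computational engine
--   of InertialRecession; informal until LandauLifshitzSuperpotential / quasiLocalMomentum land.) In a
--   lab chart in which g = G(λ(t)) + h with the weighted C³ control of InertialRecession's hypothesis
--   (|D^m h| = o(d^(-7/4)) inside the cone, m ≤ 3), for buffer spheres Sᵢ(t) of radius r_b(t) = D(t)^0.9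
--   around ξᵢ(t): (a) the Landau–Lifshitz momentum flux −∮_{Sᵢ} (−g) t^{αk}_LL dS_k equals the 1PM
--   Einstein–Infeld–Hoffmann force F_i^α(λ(t)) (linear in G·MᵢMⱼ, exact in the velocities; Newtonian
--   −MᵢMⱼ(ξᵢ−ξⱼ

/-- item stmt-FinalStateConjecture-10189 · support · rank 9 · closed · proved by Summit.FinalStateConjecture.FinalStateConjecture.Theorems.LLBalance.llBalanceLaw_assembled @ d9657a0ac4e1 (prover) · by planner
sources: arXiv:1310.1528
[support] (card P1 — LANDAU–LIFSHITZ BALANCE LAW, provable as soon as LandauLifshitzSuperpotential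
lands; chart calculus only.) For a smooth Lorentzian metric g given as a field of bilinear forms on
an open U ⊆ E4 = ℝ⁴: with 𝔤^{μν} = (−g)^(1/2) g^{μν} and H^{μανβ} = 𝔤^{μν}𝔤^{αβ} − 𝔤^{αν}𝔤^{βμ}, (i)
the identity ∂_α∂_β H^{μανβ} = 16π(−g)(G^{μν}/(8π) + t^{μν}_LL) holds pointwise (definition of t_LL
by LL §96 (96.8)–(96.9)); (ii) H is antisymmetric in (μ,α) and in (ν,β), hence ∂_μ[(−g)(G^{μν}/(8π)
+ t^{μν}_LL)] = 0 identically and, where Ric(g) = 0, ∂_μ[(−g)t^{μν}_LL] = 0; (iii) consequently for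
a coordinate sphere S_R = {x⁰ = t, |x̲ − ξ| = R} the quasi-local momentum P^ν(t) = (16π)⁻¹∮_{S_R}
∂_β H^{ν0kβ} n_k dS satisfies dP^ν/dt = −∮_{S_R} (−g) t^{νk}_LL n_k dS whenever Ric(g) = 0 on a
neighbourhood of S_R (no interior needed — the superpotential form uses the field equations ON the
sphere only); (iv) radius-averaging lemma: for any smooth density f, (1/R)∫_R^{2R} ∮_{S_ρ} f dS dρ =
(1/R)∫_{R<|x̲−ξ|<2R} f d³x, turning sphere fluxes of quadratic quantities into volume integrals
bounded by energies. Sources: Landau–Lifshitz, Classical Theory of Fields §96 and §105;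
arXiv:1310.1528 §§2–5; -/
@[route_item "route-FinalStateConjecture-EIHFluxBalance"]
def LLBalanceLaw : Prop :=
  open Literature.Geometry.Lorentzian Literature.Geometry.Lorentzian.LandauLifshitz in ∀ (g : E4 → E4 →L[ℝ] E4 →L[ℝ] ℝ) (U : Set E4), IsOpen U → ContDiffOn ℝ (⊤ : ℕ∞) g U → (∀ x ∈ U, ∀ v w : E4, g x v w = g x w v) → (∀ x ∈ U, metricDet g x < 0) → (∀ x ∈ U, ∀ μ ν : Fin 4, emComplex g x μ ν = -metricDet g x * ((8 * Real.pi)⁻¹ * einsteinUpper g x μ ν + pseudotensor g x μ ν)) ∧ (∀ x ∈ U, ∀ μ : Fin 4, ∑ ν : Fin 4, partialDeriv ν (fun y ↦ emComplex g y μ ν) x = 0) ∧ ((∀ x ∈ U, MetricCoord.ricAt g x = 0) → ∀ x ∈ U, ∀ μ : Fin 4, ∑ ν : Fin 4, partialDeriv ν (fun y ↦ -metricDet g y * pseudotensor g y μ ν) x = 0) ∧ (∀ (t R : ℝ) (ξ : E3), 0 < R → (∀ y ∈ Metric.sphere ξ R, E4.ofTimeSpace t y ∈ U) → (∀ x ∈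 U, MetricCoord.ricAt g x = 0) → ∀ μ : Fin 4, HasDerivAt (fun s ↦ quasiLocalMomentum g s ξ R μ) (-momentumFlux g t ξ R μ) t) ∧ (∀ (f : E3 → ℝ) (ξ : E3) (R : ℝ), 0 < R → Continuous f → ∫ ρ in Set.Ioo R (2 * R), ∫ y in Metric.sphere ξ ρ, f y ∂(μHE[2] : Measure E3) = ∫ y in {y : E3 | R < dist y ξ ∧ dist y ξ < 2 * R}, f y)

-- `LLBalanceLaw` holds: proved by `Summit.FinalStateConjecture.FinalStateConjecture.Theorems.LLBalance.llBalanceLaw_assembled` @ d9657a0ac4e1 (its module imports this route file, so no `_holds` link can be stated here).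

-- earlier Assembly (stmt-FinalStateConjecture-10169, replaced 2026-08-16T00:56:00Z -> stmt-FinalStateConjecture-14037): proved by Summit.FinalStateConjecture.FinalStateConjecture.Theorems.Assembly_proof @ 9564d8569bb5 — ModulatedKerrHandoff → InertialRecession → FinalStateConjecture
-- earlier Assembly (stmt-FinalStateConjecture-14037, replaced 2026-08-16T23:18:23Z -> stmt-FinalStateConjecture-17404): proved by Summit.FinalStateConjecture.FinalStateConjecture.Theorems.EIHFluxBalance.assembly_frame_proof — ModulatedKerrHandoff ∧ InertialRecession → _root_.FinalStateConjecture
/-- item stmt-FinalStateConjecture-17404 · assembly · rank 1 · closed · proved by Summit.FinalStateConjecture.FinalStateConjecture.Theorems.Assembly_proof @ 32fb9804a59d (prover) · by planner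
sources: arXiv:1710.01722, Christodoulou1999
[assembly] frame statement E′ → H′ → Statement (the thesis H′ ∧ E′ curried, E first; restated
2026-08-16 over the re-typed cruxes — the gate requires a textual change and refuses to drop an
assembly item): pure logic — tame Christodoulou genericity `IsTameChristodoulouGeneric 𝓓 P 1` is
monotone in P, and InertialRecession upgrades, pointwise in the admissible datum and the MGHD, the
handoff clause of ModulatedKerrHandoff to the Statement's settled clause; literally the deciding
theorem `closes` of this file with its two hypotheses swapped (proof `fun hE hH ↦ closes hH hE`).
PROVERS: nothing is gained by closing this bookkeeping item — `closes` below is the deciding theorem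
and already carries the proof; work the cruxes. (The earlier frame proof
Theorems/EIHFluxBalanceAssemblyFrame.lean proved the pre-re-type statement and is dead.) If you do
close it, only from a module that does NOT import this Theses file (inline the two crux bodies
verbatim), else the _holds link cannot be rendered (import cycle). -/
@[route_item "route-FinalStateConjecture-EIHFluxBalance"]
def Assembly : Prop :=
  InertialRecession → ModulatedKerrHandoff → _root_.FinalStateConjecture

-- `Assembly` holds: proved by `Summit.FinalStateConjecture.FinalStateConjecture.Theorems.Assembly_proof` @ 32fb9804a59d (its module imports this route file, so no `_holds` link can be stated here).

/-! D-0027 §2.1 — DECIDING THEOREM (planner-authored via `route open/edit --closes-file`; by planner-rrepair-FinalStateConjecture-EIHFluxBa-2f5ff35a-0 2026-08-16T23:18:23Z):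
its hypotheses are this route's items and its conclusion the sub-problem Statement (glue_lint), and it elaborates with this file. -/

@[closes "route-FinalStateConjecture-EIHFluxBalance"] theorem closes : ModulatedKerrHandoff → InertialRecession → _root_.FinalStateConjecture := by
  intro hH hE X _ _ _ _ _ _ d hd
  obtain ⟨e, F, hF, himm, h0, hinj, hD, hgood⟩ := hH X d (by
    refine ⟨hd.1, fun hq ↦ hd.2 ⟨hq.1, fun 𝒟 h𝒟 ↦ ⟨(hq.2 𝒟 h𝒟).1, ?_⟩⟩⟩
    exact hE X d hd.1 𝒟 h𝒟 (hq.2 𝒟 h𝒟).2)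
  refine ⟨e, F, hF, himm, h0, hinj, hD, fun c hc hmem ↦ hgood c hc ⟨hmem.1, fun hq ↦ hmem.2 ?_⟩⟩
  exact ⟨hq.1, fun 𝒟 h𝒟 ↦ ⟨(hq.2 𝒟 h𝒟).1, hE X (F c) hmem.1 𝒟 h𝒟 (hq.2 𝒟 h𝒟).2⟩⟩

end Summit.FinalStateConjecture.FinalStateConjecture.Theses.EIHFluxBalance
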